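import Summits.ValiantsHypothesis.ValiantsHypothesis.Theorems.LacunarySymmetroidMatrixDescartesPivotRankOneFourNine

/-!
# `MatrixDescartes` census — THE RANK-ONE `(2,4)₁` ROW: `Z₊ ≤ 9` FOR EVERY PIVOT EXPONENT AND EVERY FOUR LETTER EXPONENTS
# (ties and arbitrary order included; the lineage's rank-one register becomes `{8, 9}` in the kernel)

HONEST FRAMING.  Object-search cell `pub-symmetroid`, seat `val-sym-mdr-p1` (generation 15); helper file `--supports` the crux item
stmt-ValiantsHypothesis-18050 (`Theses.LacunarySymmetroid.MatrixDescartes`, OPEN, on HOLD) with NO closure claim.  Bookkeeping beside the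
crux: it removes the «sorted, distinct» provisos of `…PivotRankOneFourNine` so that the rank-one `(2,4)₁` bound is ONE unconditional row
statement.  Nothing here bears on `MatrixDescartes` in its window, on `DoorA26` / `DoorA34`, registers / credences, or `VP ≠ VNP`.

**THEOREM (`rankOne_four_posRoots_le_nine`).**  For every real symmetric `2 × 2` matrix `J`, every pivot exponent `e`, every exponents
`d : Fin 4 → ℕ` (any order, coincidences allowed), directions `v : Fin 4 → ℝ²` and weights `w : Fin 4 → ℝ_{>0}`, the determinant of
`X^e J + ∑ₖ w k · X^{d k} (v k)(v k)ᵀ` has AT MOST NINE distinct positive roots.  (Descartes' rule gives ten; eight is attained,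
`…PivotRankOneEight`; nine could only come from the chambers (C), (C′) of the 1/3, 3/1 splits.)
Also in the cell's `pivotPosRoots` language: `rankOne_pivotPosRoots_le_nine`.
PROOF.  A coincidence among the five pivot-type degrees `2e, e + d k` leaves at most four degrees carrying negative coefficients, hence `8`
(`elevenNomial_le_eight_of_not_injective`, Descartes); otherwise sort the letters (`Tuple.sort`) and apply `rankOne_posRoots_le_nine`.

[folklore] Descartes' rule; the lineage's files cited above.  No definitions, no named facts.
-/

-- `Summit.ValiantsHypothesis.ValiantsHypothesis.…` repeats a component by the D-0017 layout
-- (single-conjunct summit), which the `dupNamespace` linter flags; the name is mandated.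
set_option linter.dupNamespace false

open Polynomial Matrix Finset
open scoped BigOperators
open Summit.ValiantsHypothesis.ValiantsHypothesis.Theorems.LacunarySymmetroidMatrixDescartes.Pivot.TwoDirections.BlockLaw

namespace Summit.ValiantsHypothesis.ValiantsHypothesis.Theorems.LacunarySymmetroidMatrixDescartes.Pivot.RankOneCover

/-! ## 1. Coincident pivot-type degrees: eight -/

/-- If the five pivot-type degrees `2e, e+d₀, …, e+d₃` are NOT pairwise distinct (some `dₖ = e` or `dₖ = d_l`) and the pair coefficients
are non-negative, the eleven-nomial has at most eight positive roots: negative coefficients occupy at most four degrees. -/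
theorem elevenNomial_le_eight_of_not_injective (e d₀ d₁ d₂ d₃ : ℕ) (cv : Fin 11 → ℝ) (hpos : ∀ i : Fin 11, 5 ≤ (i : ℕ) → 0 ≤ cv i)
    (htie : ¬ Function.Injective (![2 * e, e + d₀, e + d₁, e + d₂, e + d₃] : Fin 5 → ℕ)) :
    ((∑ i : Fin 11, Polynomial.C (cv i) * X ^ ((![2 * e, e + d₀, e + d₁, e + d₂, e + d₃, d₀ + d₁, d₀ + d₂, d₀ + d₃, d₁ + d₂, d₁ + d₃, d₂ + d₃] : Fin 11 → ℕ) i)).roots.toFinset.filter (fun t => 0 < t)).card ≤ 8 := by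
  classical
  set g : Fin 5 → ℕ := ![2 * e, e + d₀, e + d₁, e + d₂, e + d₃] with hg
  set T : Finset ℕ := (Finset.univ : Finset (Fin 5)).image g with hT
  have hT4 : T.card ≤ 4 := by
    have hle : T.card ≤ 5 := by
      refine Finset.card_image_le.trans ?_
      simp
    by_contra h4
    have h5 : T.card = (Finset.univ : Finset (Fin 5)).card := by
      simp only [Finset.card_univ, Fintype.card_fin]; omega
    have hinjOn := Finset.injOn_of_card_image_eq h5
    exact htie fun i j hij => hinjOn (Finset.mem_univ i) (Finset.mem_univ j) hij
  have hmem : ∀ n, (∑ i : Fin 11, Polynomial.C (cv i) * X ^ ((![2 * e, e + d₀, e + d₁, e + d₂, e + d₃, d₀ + d₁, d₀ + d₂, d₀ + d₃, d₁ + d₂, d₁ + d₃, d₂ + d₃] : Fin 11 → ℕ) i)).coeff n < 0 → n ∈ T := by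
    intro n hn
    have h := RankOneReduction.eq_pivotDegree_of_coeff_neg e d₀ d₁ d₂ d₃ cv hpos n hn
    rw [hT, Finset.mem_image]
    rcases h with h | h | h | h | h
    · exact ⟨0, Finset.mem_univ _, by rw [hg, h]; rfl⟩
    · exact ⟨1, Finset.mem_univ _, by rw [hg, h]; rfl⟩
    · exact ⟨2, Finset.mem_univ _, by rw [hg, h]; rfl⟩
    · exact ⟨3, Finset.mem_univ _, by rw [hg, h]; rfl⟩
    · exact ⟨4, Finset.mem_univ _, by rw [hg, h]; rfl⟩
  have := Pivot.TwoDescartes.card_posRoots_le_two_mul_card _ T hmem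
  omega

/-! ## 2. Sorted letter exponents, ties allowed -/

/-- Sorted exponents `d₀ ≤ d₁ ≤ d₂ ≤ d₃`, pivot exponent `e` arbitrary (coincidences allowed): `Z₊ ≤ 9`. -/
theorem rankOne_sorted_posRoots_le_nine (e d₀ d₁ d₂ d₃ : ℕ) (h01 : d₀ ≤ d₁) (h12 : d₁ ≤ d₂) (h23 : d₂ ≤ d₃)
    (J : Matrix (Fin 2) (Fin 2) ℝ) (hJ : J 0 1 = J 1 0) (v₀ v₁ v₂ v₃ : Fin 2 → ℝ) (w₀ w₁ w₂ w₃ : ℝ)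
    (hw₀ : 0 < w₀) (hw₁ : 0 < w₁) (hw₂ : 0 < w₂) (hw₃ : 0 < w₃) :
    ((Matrix.det (((X : ℝ[X]) ^ e) • J.map Polynomial.C
        + (Polynomial.C w₀ * X ^ d₀) • (vecMulVec v₀ v₀).map Polynomial.C
        + (Polynomial.C w₁ * X ^ d₁) • (vecMulVec v₁ v₁).map Polynomial.C
        + (Polynomial.C w₂ * X ^ d₂) • (vecMulVec v₂ v₂).map Polynomial.C
        + (Polynomial.C w₃ * X ^ d₃) • (vecMulVec v₃ v₃).map Polynomial.C)).roots.toFinset.filter (fun t => 0 < t)).card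
      ≤ 9 := by
  classical
  by_cases hdist : d₀ < d₁ ∧ d₁ < d₂ ∧ d₂ < d₃ ∧ e ≠ d₀ ∧ e ≠ d₁ ∧ e ≠ d₂ ∧ e ≠ d₃
  · obtain ⟨a, b, c, f0, f1, f2, f3⟩ := hdist
    exact rankOne_posRoots_le_nine e d₀ d₁ d₂ d₃ a b c f0 f1 f2 f3 J hJ v₀ v₁ v₂ v₃ w₀ w₁ w₂ w₃ hw₀ hw₁ hw₂ hw₃
  -- a coincidence among the pivot-type degrees
  rw [det_rankOne_four_sum]
  refine (elevenNomial_le_eight_of_not_injective e d₀ d₁ d₂ d₃ _ (fun i hi => ?_) (fun hinj => hdist ?_)).trans (by norm_num)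
  · fin_cases i <;>
      first
        | (simp only [Fin.isValue, Fin.reduceFinMk, Matrix.cons_val]; positivity)
        | (norm_num at hi)
  · have n01 : (![2 * e, e + d₀, e + d₁, e + d₂, e + d₃] : Fin 5 → ℕ) 1 ≠ (![2 * e, e + d₀, e + d₁, e + d₂, e + d₃] : Fin 5 → ℕ) 2 :=
      fun h => absurd (hinj h) (by decide)
    have n12 : (![2 * e, e + d₀, e + d₁, e + d₂, e + d₃] : Fin 5 → ℕ) 2 ≠ (![2 * e, e + d₀, e + d₁, e + d₂, e + d₃] : Fin 5 → ℕ) 3 :=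
      fun h => absurd (hinj h) (by decide)
    have n23 : (![2 * e, e + d₀, e + d₁, e + d₂, e + d₃] : Fin 5 → ℕ) 3 ≠ (![2 * e, e + d₀, e + d₁, e + d₂, e + d₃] : Fin 5 → ℕ) 4 :=
      fun h => absurd (hinj h) (by decide)
    have n0 : (![2 * e, e + d₀, e + d₁, e + d₂, e + d₃] : Fin 5 → ℕ) 0 ≠ (![2 * e, e + d₀, e + d₁, e + d₂, e + d₃] : Fin 5 → ℕ) 1 :=
      fun h => absurd (hinj h) (by decide)
    have n1 : (![2 * e, e + d₀, e + d₁, e + d₂, e + d₃] : Fin 5 → ℕ) 0 ≠ (![2 * e, e + d₀, e + d₁, e + d₂, e + d₃] : Fin 5 → ℕ) 2 :=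
      fun h => absurd (hinj h) (by decide)
    have n2 : (![2 * e, e + d₀, e + d₁, e + d₂, e + d₃] : Fin 5 → ℕ) 0 ≠ (![2 * e, e + d₀, e + d₁, e + d₂, e + d₃] : Fin 5 → ℕ) 3 :=
      fun h => absurd (hinj h) (by decide)
    have n3 : (![2 * e, e + d₀, e + d₁, e + d₂, e + d₃] : Fin 5 → ℕ) 0 ≠ (![2 * e, e + d₀, e + d₁, e + d₂, e + d₃] : Fin 5 → ℕ) 4 :=
      fun h => absurd (hinj h) (by decide)
    simp only [Fin.isValue, Matrix.cons_val_zero, Matrix.cons_val_one, Matrix.cons_val] at n01 n12 n23 n0 n1 n2 n3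
    omega

/-! ## 3. The row statement -/

/-- **THE RANK-ONE `(2,4)₁` ROW: `Z₊ ≤ 9`.**  `J` real symmetric, `e : ℕ`, `d : Fin 4 → ℕ` ARBITRARY (any order, ties allowed),
`v : Fin 4 → ℝ²` arbitrary, `w : Fin 4 → ℝ` positive. [this file] -/
theorem rankOne_four_posRoots_le_nine (e : ℕ) (d : Fin 4 → ℕ) (J : Matrix (Fin 2) (Fin 2) ℝ) (hJ : J 0 1 = J 1 0)
    (v : Fin 4 → Fin 2 → ℝ) (w : Fin 4 → ℝ) (hw : ∀ k, 0 < w k) :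
    ((Matrix.det (((X : ℝ[X]) ^ e) • J.map Polynomial.C
        + ∑ k : Fin 4, (Polynomial.C (w k) * X ^ d k) • (vecMulVec (v k) (v k)).map Polynomial.C)).roots.toFinset.filter
          (fun t => 0 < t)).card ≤ 9 := by
  classical
  set σ : Equiv.Perm (Fin 4) := Tuple.sort d with hσ
  have hmono : Monotone (d ∘ σ) := Tuple.monotone_sort d
  have hsum : (∑ k : Fin 4, (Polynomial.C (w k) * X ^ d k) • (vecMulVec (v k) (v k)).map Polynomial.C)
      = ∑ k : Fin 4, (Polynomial.C (w (σ k)) * X ^ d (σ k)) • (vecMulVec (v (σ k)) (v (σ k))).map Polynomial.C :=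
    (Equiv.sum_comp σ (fun k => (Polynomial.C (w k) * X ^ d k) • (vecMulVec (v k) (v k)).map Polynomial.C)).symm
  rw [hsum, Fin.sum_univ_four, ← add_assoc, ← add_assoc, ← add_assoc]
  have h01 : d (σ 0) ≤ d (σ 1) := hmono (show (0 : Fin 4) ≤ 1 by decide)
  have h12 : d (σ 1) ≤ d (σ 2) := hmono (show (1 : Fin 4) ≤ 2 by decide)
  have h23 : d (σ 2) ≤ d (σ 3) := hmono (show (2 : Fin 4) ≤ 3 by decide)
  exact rankOne_sorted_posRoots_le_nine e (d (σ 0)) (d (σ 1)) (d (σ 2)) (d (σ 3)) h01 h12 h23 J hJ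
    (v (σ 0)) (v (σ 1)) (v (σ 2)) (v (σ 3)) (w (σ 0)) (w (σ 1)) (w (σ 2)) (w (σ 3)) (hw _) (hw _) (hw _) (hw _)

/-- **The same row in the cell's `pivotPosRoots` language**: for rank-one letters `P k = w k • (v k)(v k)ᵀ` (`w k > 0`) and a symmetric
pivot, `pivotPosRoots e d J P ≤ 9` at `(m, K) = (2, 4)` — every `e`, every `d : Fin 4 → ℕ`. [this file] -/
theorem rankOne_pivotPosRoots_le_nine (e : ℕ) (d : Fin 4 → ℕ) (J : Matrix (Fin 2) (Fin 2) ℝ) (hJ : J.IsSymm)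
    (v : Fin 4 → Fin 2 → ℝ) (w : Fin 4 → ℝ) (hw : ∀ k, 0 < w k) :
    Pivot.pivotPosRoots e d J (fun k => w k • vecMulVec (v k) (v k)) ≤ 9 := by
  classical
  unfold Pivot.pivotPosRoots
  have hconv : (∑ k : Fin 4, ((X : ℝ[X]) ^ d k) • ((w k • vecMulVec (v k) (v k)).map Polynomial.C))
      = ∑ k : Fin 4, (Polynomial.C (w k) * X ^ d k) • (vecMulVec (v k) (v k)).map Polynomial.C := by
    refine Finset.sum_congr rfl fun k _ => ?_
    ext i j
    simp only [Matrix.smul_apply, Matrix.map_apply, smul_eq_mul, Polynomial.C_mul]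
    ring
  have h01 : J 0 1 = J 1 0 := by
    have h := congrFun (congrFun hJ 0) 1
    simpa [Matrix.transpose_apply] using h.symm
  rw [hconv]
  exact rankOne_four_posRoots_le_nine e d J h01 v w hw

end Summit.ValiantsHypothesis.ValiantsHypothesis.Theorems.LacunarySymmetroidMatrixDescartes.Pivot.RankOneCover
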